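import Summits.MatrixMultiplication.MatrixMultiplication.Theorems.FarEdgeDescentTwistRigidityRestriction
import HarnessLib

/-!
# The weighted star `𝔖^w_n(L)` (Cohn–Umans weighted matrix multiplication glued to a coherent
# leaf): full slices, and the transpose twist degenerates to no weighted star

Route `FarEdgeDescent` (cell `decomp-mm`, lens 2 «structural dichotomy (special vs generic)»,
gen 32), Kernel VII part 1; support for the aside `SubLogRate` (stmt-MatrixMultiplication-25371)
via the named idea «Q-𝔖 / twist cashing» (`Theorems/FarEdgeDescentTwistRigidityCore.lean`).

Kernel VI (`…TwistRigidity*.lean`) split the permutation twists `𝔖_φ` of the special leaf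
`⟨n,n,2L⟩` into SPECIAL (`φ` a product permutation, `𝔖_φ ≅ ⟨n,n,2L⟩`) and GENERIC (all others,
restriction-incomparable with `⟨n,n,2L⟩`).  Gen 32 refines the generic stratum.  Its model object is
the **weighted star** `𝔖^w_n(L)`, the tensor of `(X, (Y, Y')) ↦ (XY, (w ∘ X)Y')` where `w ∘ X` is the
entrywise (Hadamard) product with a weight table `w : Fin n × Fin n → K`: the coherent leaf
`⟨n,n,L⟩` glued along `X` to a WEIGHTED matrix product in the sense of Cohn–Umans (the tensors with
the support of `⟨n,n,L⟩`, [CohnUmans2013, §3]); and its transposed sibling `𝔖^{wᵀ}_n(L)`, the tensor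
of `(X, (Y, Y')) ↦ (XY, (w ∘ X)ᵀY')`.  `w ≡ 1` gives `⟨n,n,2L⟩` resp. the twisted star `𝔖_n(L)` of
Kernel II; at `n = 2` the sign table `w = sgn` (`-1` at `(1,0)`, `+1` elsewhere) gives the two
normal forms `𝔖^♭`, `𝔖^{♭ᵀ}` of the sixteen generic non-transpose twists (part 2,
`…SignTwist.lean`: `𝔖_{T_rd} ≅ 𝔖_{T_cd} ≅ 𝔖^♭`, `𝔖_{C₃} ≅ 𝔖^{♭ᵀ}`).

This file proves, over any field:
* `weightedStar_fullSlice`: for `2L ≤ n` and `w` nowhere zero, `𝔖^w_n(L)` has a FULL SLICE (a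
  third-slot contraction whose `Z × X` matrix is right-invertible): read `L` columns of `X` on the
  coherent leaf and `L` other columns of `w ∘ X` on the weighted leaf;
* `twistedStar_pow_not_algDegeneratesTo_weightedStar`: hence, by the pairing obstruction of
  Kernel II (`not_algDegeneratesTo_kroneckerPow_of_pairing`, BCS (15.19)), NO Kronecker power of a
  nowhere-zero weighted star is a degeneration of the same power of the transpose twist `𝔖_n(L)`
  (`1 ≤ L`, `2L ≤ n`, `N ≥ 1`); `w ≡ 1` is Kernel II itself, `w = sgn` is «`ᵀ ⋭ ♭` at every
  finite level»;
* `signTStar_fullSlice`, `twistedStar_pow_not_algDegeneratesTo_signTStar`: the same for the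
  transposed sign star `𝔖^{♭ᵀ}` at `n = 2`, `L = 1` (its full slices are not of graph type: the
  contraction `ψ = ψ' = (1,1)` has determinant `w₀₀w₁₁ - w₀₁w₁₀ = 2`), in characteristic `≠ 2`.
So the transpose class degenerates to neither of the two other generic classes, at any power.

References: H. Cohn, C. Umans, *Fast matrix multiplication using coherent configurations*, SODA
2013, §3 (weighted matrix multiplication, s-rank) [CohnUmans2013]; M. Bläser, M. Christandl,
J. Zuiddam, *The border support rank of two-by-two matrix multiplication is seven*, Chic. J. TCS
2018, Thm. 1–2, Lemma 3 [BlaserChristandlZuiddam2017]; P. Bürgisser, M. Clausen,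
M. A. Shokrollahi, *Algebraic Complexity Theory* (1997), (15.19), (15.20) [BurgisserClausenShokrollahi1997].
-/

noncomputable section

open scoped BigOperators

set_option linter.dupNamespace false

namespace Summit.MatrixMultiplication.MatrixMultiplication.Theorems.FarEdgeDescentSignTwist

open Literature.Computability.AlgebraicComplexity
open Summit.MatrixMultiplication.MatrixMultiplication.Theorems.FarEdgeDescentTwistedStar
open Summit.MatrixMultiplication.MatrixMultiplication.Theorems.FarEdgeDescentPairingObstruction

universe u

section Defs

variable (K : Type u) [Field K]

/-- **The weighted star `𝔖^w_n(L)`**: slots as for `twistedStar` / `permStar`; the `inl` leaf is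
`⟨n,n,L⟩`, the `inr` leaf is `⟨n,n,L⟩` with the entry `X_b` weighted by `w b`
(`(X, (Y, Y')) ↦ (XY, (w ∘ X)Y')`); mixed blocks vanish. [cite: CohnUmans2013, §3] -/
def weightedStar (n L : ℕ) (w : Fin n × Fin n → K) :
    (Fin n × Fin L) ⊕ (Fin n × Fin L) → Fin n × Fin n → (Fin n × Fin L) ⊕ (Fin n × Fin L) → K
  | Sum.inl a, b, Sum.inl c => matMulTensor K n n L a b c
  | Sum.inr a, b, Sum.inr c => w b * matMulTensor K n n L a b c
  | _, _, _ => 0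

/-- **The transposed weighted star `𝔖^{wᵀ}_n(L)`**: the `inr` leaf is `⟨n,n,L⟩` read through
`(w ∘ X)ᵀ` (`(X, (Y, Y')) ↦ (XY, (w ∘ X)ᵀY')`). [cite: CohnUmans2013, §3] -/
def weightedTStar (n L : ℕ) (w : Fin n × Fin n → K) :
    (Fin n × Fin L) ⊕ (Fin n × Fin L) → Fin n × Fin n → (Fin n × Fin L) ⊕ (Fin n × Fin L) → K
  | Sum.inl a, b, Sum.inl c => matMulTensor K n n L a b c
  | Sum.inr a, b, Sum.inr c => w b * matMulTensor K n n L a b.swap c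
  | _, _, _ => 0

/-- **The sign table `sgn` on the `2 × 2` grid**: `-1` at `(1,0)`, `+1` elsewhere (the cocycle
class `w₀₀w₁₁/(w₀₁w₁₀) = -1`, Bläser–Christandl–Zuiddam's `⟨2,2,2⟩_{-1}` up to `GL₄³`).
[cite: BlaserChristandlZuiddam2017, Lemma 3] -/
def sgnWeight (b : Fin 2 × Fin 2) : K := if b = (1, 0) then -1 else 1

/-- **The sign star `𝔖^♭ = 𝔖^{sgn}_2(1)`**: `(X, (y, y')) ↦ (Xy, X^♭y')`, `X^♭ = sgn ∘ X`. [cite: BlaserChristandlZuiddam2017, Def. 5] -/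
abbrev signStar := weightedStar K 2 1 (sgnWeight K)

/-- **The transposed sign star `𝔖^{♭ᵀ} = 𝔖^{sgnᵀ}_2(1)`**: `(X, (y, y')) ↦ (Xy, (X^♭)ᵀy')`. [cite: CohnUmans2013, §3] -/
abbrev signTStar := weightedTStar K 2 1 (sgnWeight K)

end Defs

variable {K : Type u} [Field K]

/-! ## Block formulas -/

section Blocks
variable (n L : ℕ) (w : Fin n × Fin n → K)

/-- Coherent block of `𝔖^w`: `⟨n,n,L⟩`. [folklore] -/
@[simp] theorem weightedStar_inl_inl (a : Fin n × Fin L) (b : Fin n × Fin n) (c : Fin n × Fin L) :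
    weightedStar K n L w (Sum.inl a) b (Sum.inl c) = matMulTensor K n n L a b c := rfl
/-- Weighted block of `𝔖^w`: `w_b · ⟨n,n,L⟩`. [folklore] -/
@[simp] theorem weightedStar_inr_inr (a : Fin n × Fin L) (b : Fin n × Fin n) (c : Fin n × Fin L) :
    weightedStar K n L w (Sum.inr a) b (Sum.inr c) = w b * matMulTensor K n n L a b c := rfl
/-- Mixed block of `𝔖^w` vanishes. [folklore] -/
@[simp] theorem weightedStar_inl_inr (a : Fin n × Fin L) (b : Fin n × Fin n) (c : Fin n × Fin L) :
    weightedStar K n L w (Sum.inl a) b (Sum.inr c) = 0 := rfl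
/-- Mixed block of `𝔖^w` vanishes. [folklore] -/
@[simp] theorem weightedStar_inr_inl (a : Fin n × Fin L) (b : Fin n × Fin n) (c : Fin n × Fin L) :
    weightedStar K n L w (Sum.inr a) b (Sum.inl c) = 0 := rfl
/-- Coherent block of `𝔖^{wᵀ}`: `⟨n,n,L⟩`. [folklore] -/
@[simp] theorem weightedTStar_inl_inl (a : Fin n × Fin L) (b : Fin n × Fin n) (c : Fin n × Fin L) :
    weightedTStar K n L w (Sum.inl a) b (Sum.inl c) = matMulTensor K n n L a b c := rfl
/-- Weighted transposed block of `𝔖^{wᵀ}`: `w_b · ⟨n,n,L⟩` read through `Xᵀ`. [folklore] -/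
@[simp] theorem weightedTStar_inr_inr (a : Fin n × Fin L) (b : Fin n × Fin n) (c : Fin n × Fin L) :
    weightedTStar K n L w (Sum.inr a) b (Sum.inr c) = w b * matMulTensor K n n L a b.swap c := rfl
/-- Mixed block of `𝔖^{wᵀ}` vanishes. [folklore] -/
@[simp] theorem weightedTStar_inl_inr (a : Fin n × Fin L) (b : Fin n × Fin n) (c : Fin n × Fin L) :
    weightedTStar K n L w (Sum.inl a) b (Sum.inr c) = 0 := rfl
/-- Mixed block of `𝔖^{wᵀ}` vanishes. [folklore] -/
@[simp] theorem weightedTStar_inr_inl (a : Fin n × Fin L) (b : Fin n × Fin n) (c : Fin n × Fin L) :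
    weightedTStar K n L w (Sum.inr a) b (Sum.inl c) = 0 := rfl

/-- **Unit weights give the coherent pair**: `𝔖^1_n(L) = 𝔖_{id}` (Kernel VI's `permStar` at the
identity permutation, `≅ ⟨n,n,2L⟩`). [folklore] -/
theorem weightedStar_one : weightedStar K n L (fun _ => 1) =
    FarEdgeDescentTwistRigidity.permStar K n L (Equiv.refl _) := by
  funext a b c
  rcases a with a | a <;> rcases c with c | c <;> simp [FarEdgeDescentTwistRigidity.permStar]

/-- **Unit weights, transposed, give the twisted star**: `𝔖^{1ᵀ}_n(L) = 𝔖_n(L)`. [folklore] -/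
theorem weightedTStar_one : weightedTStar K n L (fun _ => 1) = twistedStar K n L := by
  funext a b c
  rcases a with a | a <;> rcases c with c | c <;> simp [twistedStar]

end Blocks

/-! ## The full slice of a weighted star (`2L ≤ n`, `w` nowhere zero) -/

section FullSlice
variable (n L : ℕ) (w : Fin n × Fin n → K)

/-- The two disjoint column embeddings `l ↦ l` and `l ↦ L + l` of `Fin L` into `Fin n`
(`2L ≤ n`). [folklore] -/
def colLo (h2 : L + L ≤ n) (l : Fin L) : Fin n := ⟨l, by omega⟩

/-- See `colLo`. [folklore] -/
def colHi (h2 : L + L ≤ n) (l : Fin L) : Fin n := ⟨L + l, by omega⟩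

/-- `colLo` is injective. [folklore] -/
theorem colLo_injective (h2 : L + L ≤ n) : Function.Injective (colLo n L h2) := by
  intro l l' h; simp only [colLo, Fin.mk.injEq] at h; exact Fin.ext (by omega)

/-- `colHi` is injective. [folklore] -/
theorem colHi_injective (h2 : L + L ≤ n) : Function.Injective (colHi n L h2) := by
  intro l l' h; simp only [colHi, Fin.mk.injEq] at h; exact Fin.ext (by omega)

/-- `colLo` and `colHi` have disjoint images. [folklore] -/
theorem colLo_ne_colHi (h2 : L + L ≤ n) (l l' : Fin L) : colLo n L h2 l ≠ colHi n L h2 l' := by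
  intro h; simp only [colLo, colHi, Fin.mk.injEq] at h; omega

/-- **The column-reading contraction `ψ₀` of `𝔖^w_n(L)`**: on the coherent leaf `Y = ∑_l E_{l,l}`
(read column `l` of `X` into `Z_{·,l}`), on the weighted leaf `Y' = ∑_l E_{L+l,l}` (read column
`L+l` of `w ∘ X` into `Z'_{·,l}`). [folklore] -/
def colSlice (h2 : L + L ≤ n) : (Fin n × Fin L) ⊕ (Fin n × Fin L) → K :=
  Sum.elim (fun c => if c.1 = colLo n L h2 c.2 then 1 else 0)
    (fun c => if c.1 = colHi n L h2 c.2 then 1 else 0)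

/-- **Its right inverse `T₀`** (divide the weighted leaf by the weights read). [folklore] -/
def colSliceInv (h2 : L + L ≤ n) (b : Fin n × Fin n) : (Fin n × Fin L) ⊕ (Fin n × Fin L) → K :=
  Sum.elim (fun a' => if b.1 = a'.1 ∧ b.2 = colLo n L h2 a'.2 then 1 else 0)
    (fun a' => if b.1 = a'.1 ∧ b.2 = colHi n L h2 a'.2 then (w b)⁻¹ else 0)

/-- The contracted slice of `𝔖^w_n(L)` along `colSlice`: on the coherent leaf the graph slice of
`⟨n,n,L⟩` along `colLo`, on the weighted leaf `w b` times the graph slice along `colHi`. [folklore] -/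
theorem weightedStar_slice (h2 : L + L ≤ n) (a : (Fin n × Fin L) ⊕ (Fin n × Fin L))
    (b : Fin n × Fin n) :
    ∑ c, colSlice n L h2 c * weightedStar K n L w a b c =
      Sum.elim (fun a₁ => if a₁.1 = b.1 ∧ b.2 = colLo n L h2 a₁.2 then (1 : K) else 0)
        (fun a₂ => if a₂.1 = b.1 ∧ b.2 = colHi n L h2 a₂.2 then w b else 0) a := by
  rcases a with a₁ | a₂
  · simp only [Fintype.sum_sum_type, colSlice, Sum.elim_inl, Sum.elim_inr, weightedStar_inl_inl,
      weightedStar_inl_inr, mul_zero, Finset.sum_const_zero, add_zero]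
    exact matMulTensor_slice_graph n n L (colLo n L h2) a₁ b
  · simp only [Fintype.sum_sum_type, colSlice, Sum.elim_inl, Sum.elim_inr, weightedStar_inr_inl,
      weightedStar_inr_inr, mul_zero, Finset.sum_const_zero, zero_add]
    have e : ∀ c : Fin n × Fin L, (if c.1 = colHi n L h2 c.2 then (1 : K) else 0) *
        (w b * matMulTensor K n n L a₂ b c) =
        w b * ((if c.1 = colHi n L h2 c.2 then (1 : K) else 0) * matMulTensor K n n L a₂ b c) :=
      fun c => by ring
    simp only [e, ← Finset.mul_sum, matMulTensor_slice_graph n n L (colHi n L h2) a₂ b]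
    split_ifs <;> simp

/-- **The column slice of `𝔖^w_n(L)` is full** (`2L ≤ n`, `w` nowhere zero): `colSliceInv` is a
right inverse of the contracted slice. [folklore] -/
theorem weightedStar_fullSlice (h2 : L + L ≤ n) (hw : ∀ b, w b ≠ 0)
    (a a' : (Fin n × Fin L) ⊕ (Fin n × Fin L)) :
    ∑ b, (∑ c, colSlice n L h2 c * weightedStar K n L w a b c) * colSliceInv n L w h2 b a' =
      if a = a' then 1 else 0 := by
  simp only [weightedStar_slice]
  rcases a with a₁ | a₂ <;> rcases a' with a₁' | a₂'
  · -- coherent × coherent: Kernel II's graph slice of `⟨n,n,L⟩`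
    simp only [Sum.elim_inl, colSliceInv, Sum.inl.injEq]
    have h := matMulTensor_fullSlice (K := K) n n L (colLo n L h2) (colLo_injective n L h2) a₁ a₁'
    simp only [matMulTensor_slice_graph] at h
    exact h
  · simp only [Sum.elim_inl, colSliceInv, Sum.elim_inr, reduceCtorEq, if_false]
    refine Finset.sum_eq_zero fun b _ => ?_
    split_ifs with h₁ h₂
    · exact absurd (h₁.2.symm.trans h₂.2) (colLo_ne_colHi n L h2 _ _)
    all_goals simp
  · simp only [Sum.elim_inr, colSliceInv, Sum.elim_inl, reduceCtorEq, if_false]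
    refine Finset.sum_eq_zero fun b _ => ?_
    split_ifs with h₁ h₂
    · exact absurd (h₂.2.symm.trans h₁.2) (colLo_ne_colHi n L h2 _ _)
    all_goals simp
  · simp only [Sum.elim_inr, colSliceInv, Sum.inr.injEq]
    rw [Finset.sum_eq_single (a₂.1, colHi n L h2 a₂.2)]
    · simp only [and_self, if_true]
      by_cases h : a₂ = a₂'
      · subst h; simp [hw]
      · rw [if_neg h, if_neg]
        · simp
        · rintro ⟨h1, h3⟩
          exact h (Prod.ext h1 (colHi_injective n L h2 h3))
    · intro b _ hb
      have : ¬ (a₂.1 = b.1 ∧ b.2 = colHi n L h2 a₂.2) := by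
        rintro ⟨h1, h3⟩; exact hb (Prod.ext h1.symm h3)
      rw [if_neg this, zero_mul]
    · intro h; exact absurd (Finset.mem_univ _) h

end FullSlice

/-! ## The transpose twist degenerates to no weighted star -/

section Transpose
variable (n L : ℕ) (w : Fin n × Fin n → K)

/-- **`𝔖^w_n(L)` is not a degeneration of the twisted star `𝔖_n(L)`** (`1 ≤ L`, `2L ≤ n`, `w`
nowhere zero, any field): the alternating self-pairing of `𝔖_n(L)` (Kernel II) against the full
column slice of `𝔖^w_n(L)`.  `w ≡ 1` is Kernel II's `twistedStar_not_algDegeneratesTo`.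
[cite: BurgisserClausenShokrollahi1997, (15.19)] -/
theorem twistedStar_not_algDegeneratesTo_weightedStar (hL : 1 ≤ L) (h2 : L + L ≤ n)
    (hw : ∀ b, w b ≠ 0) :
    ¬ AlgDegeneratesTo (twistedStar K n L) (weightedStar K n L w) := by
  classical
  haveI : Nonempty ((Fin n × Fin L) ⊕ (Fin n × Fin L)) :=
    ⟨Sum.inl (⟨0, by omega⟩, ⟨0, by omega⟩)⟩
  refine not_algDegeneratesTo_of_pairing (twistedStar K n L) (weightedStar K n L w)
    (blockPairing (-1)) (fun w' u => blockPairing (-1) u w')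
    (blockPairing_leftInverse (-1) (by ring) n L) (twistedStar_alt1 n L) (twistedStar_alt2 n L)
    (colSlice n L h2) (colSliceInv n L w h2) (weightedStar_fullSlice n L w h2 hw) le_rfl

/-- **No Kronecker power of `𝔖^w_n(L)` is a degeneration of the same power of `𝔖_n(L)`**
(`1 ≤ L`, `2L ≤ n`, `w` nowhere zero, `N ≥ 1`). [cite: BurgisserClausenShokrollahi1997, (15.19), (15.25)] -/
theorem twistedStar_pow_not_algDegeneratesTo_weightedStar (N : ℕ) (hL : 1 ≤ L) (h2 : L + L ≤ n)
    (hw : ∀ b, w b ≠ 0) (hN : 1 ≤ N) :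
    ¬ AlgDegeneratesTo (kroneckerPow (twistedStar K n L) N)
      (kroneckerPow (weightedStar K n L w) N) := by
  classical
  obtain ⟨N', rfl⟩ := Nat.exists_eq_add_of_le' hN
  haveI : Nonempty ((Fin n × Fin L) ⊕ (Fin n × Fin L)) :=
    ⟨Sum.inl (⟨0, by omega⟩, ⟨0, by omega⟩)⟩
  exact not_algDegeneratesTo_kroneckerPow_of_pairing (twistedStar K n L) (weightedStar K n L w)
    (blockPairing (-1)) (blockPairing 1) (fun w' u => blockPairing (-1) u w')
    (fun w' u => blockPairing 1 u w') (blockPairing_leftInverse (-1) (by ring) n L)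
    (blockPairing_leftInverse 1 (by ring) n L) (twistedStar_alt1 n L) (twistedStar_alt2 n L)
    (twistedStar_sym n L) (colSlice n L h2) (colSliceInv n L w h2)
    (weightedStar_fullSlice n L w h2 hw) le_rfl N'

/-- **Nor a restriction** (order-`0` degeneration). [cite: BurgisserClausenShokrollahi1997, (15.20)] -/
theorem twistedStar_pow_not_restrictsTo_weightedStar (N : ℕ) (hL : 1 ≤ L) (h2 : L + L ≤ n)
    (hw : ∀ b, w b ≠ 0) (hN : 1 ≤ N) :
    ¬ TensorRestrictsTo (kroneckerPow (twistedStar K n L) N)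
      (kroneckerPow (weightedStar K n L w) N) :=
  fun h => twistedStar_pow_not_algDegeneratesTo_weightedStar n L w N hL h2 hw hN h.algDegeneratesTo

end Transpose

/-! ## The transposed sign star `𝔖^{♭ᵀ}` (`n = 2`, `L = 1`): a non-graph full slice -/

section SignT

/-- `sgn` is nowhere zero in characteristic `≠ 2` (indeed `±1`; `-1 ≠ 0` always). [folklore] -/
theorem sgnWeight_ne_zero (b : Fin 2 × Fin 2) : sgnWeight K b ≠ 0 := by
  unfold sgnWeight; split_ifs <;> simp

/-- **The contraction `ψ = ψ' = (1, 1)` of `𝔖^{♭ᵀ}`** (sum both columns on each leaf). [folklore] -/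
def onesSlice : (Fin 2 × Fin 1) ⊕ (Fin 2 × Fin 1) → K := fun _ => 1

/-- **Its right inverse** `T₀ = S₀⁻¹` for the `4 × 4` slice
`S₀ = [Z₀ = x₀₀+x₀₁; Z₁ = x₁₀+x₁₁; Z'₀ = x₀₀-x₁₀; Z'₁ = x₀₁+x₁₁]` of determinant `2`:
`x₀₀ = ½(Z₀+Z₁+Z'₀-Z'₁)`, `x₀₁ = ½(Z₀-Z₁-Z'₀+Z'₁)`, `x₁₀ = ½(Z₀+Z₁-Z'₀-Z'₁)`,
`x₁₁ = ½(-Z₀+Z₁+Z'₀+Z'₁)` (entries `±½`). [folklore] -/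
def onesSliceInv (b : Fin 2 × Fin 2) (a' : (Fin 2 × Fin 1) ⊕ (Fin 2 × Fin 1)) : K :=
  (2 : K)⁻¹ * Sum.elim
    (fun a₁ => if b = (0, 0) then 1
      else if b = (0, 1) then (if a₁.1 = 0 then 1 else -1)
      else if b = (1, 0) then 1
      else (if a₁.1 = 0 then -1 else 1))
    (fun a₂ => if b = (0, 0) then (if a₂.1 = 0 then 1 else -1)
      else if b = (0, 1) then (if a₂.1 = 0 then -1 else 1)
      else if b = (1, 0) then -1
      else 1) a'

/-- The row sums of a matrix product leaf: `∑_c ⟨k,m,p⟩_{abc} = [a.1 = b.1]`. [folklore] -/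
theorem sum_matMulTensor_third (k m p : ℕ) (a : Fin k × Fin p) (b : Fin k × Fin m) :
    ∑ c : Fin m × Fin p, matMulTensor K k m p a b c = if a.1 = b.1 then 1 else 0 := by
  rw [Finset.sum_eq_single (b.2, a.2)]
  · unfold matMulTensor; by_cases h : a.1 = b.1 <;> simp [h]
  · exact fun c _ hc => if_neg fun ⟨_, h1, h3⟩ => hc (Prod.ext h1.symm h3.symm)
  · simp

/-- The `(1,1)`-contracted slice of `𝔖^{wᵀ}_2(1)`: `Z_i = ∑_j x_{ij}`, `Z'_i = ∑_j w_{ji} x_{ji}`. [folklore] -/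
theorem weightedTStar_onesSlice (w : Fin 2 × Fin 2 → K) (a : (Fin 2 × Fin 1) ⊕ (Fin 2 × Fin 1))
    (b : Fin 2 × Fin 2) :
    ∑ c, onesSlice (K := K) c * weightedTStar K 2 1 w a b c =
      Sum.elim (fun a₁ => if a₁.1 = b.1 then (1 : K) else 0)
        (fun a₂ => if a₂.1 = b.2 then w b else 0) a := by
  simp only [onesSlice, one_mul]
  rcases a with a₁ | a₂
  · simp only [Fintype.sum_sum_type, weightedTStar_inl_inl, weightedTStar_inl_inr,
      Finset.sum_const_zero, add_zero, Sum.elim_inl]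
    exact sum_matMulTensor_third 2 2 1 a₁ b
  · simp only [Fintype.sum_sum_type, weightedTStar_inr_inl, weightedTStar_inr_inr,
      Finset.sum_const_zero, zero_add, Sum.elim_inr, ← Finset.mul_sum,
      sum_matMulTensor_third 2 2 1 a₂ b.swap, Prod.fst_swap]
    split_ifs <;> simp

/-- **The `(1,1)`-slice of `𝔖^{♭ᵀ}` is full** in characteristic `≠ 2`. [folklore] -/
theorem signTStar_fullSlice (h2 : (2 : K) ≠ 0) (a a' : (Fin 2 × Fin 1) ⊕ (Fin 2 × Fin 1)) :
    ∑ b, (∑ c, onesSlice (K := K) c * signTStar K a b c) * onesSliceInv (K := K) b a' =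
      if a = a' then 1 else 0 := by
  simp only [signTStar, weightedTStar_onesSlice]
  rcases a with ⟨i, l⟩ | ⟨i, l⟩ <;> rcases a' with ⟨i', l'⟩ | ⟨i', l'⟩ <;>
  · have hl : l = 0 := Subsingleton.elim _ _
    have hl' : l' = 0 := Subsingleton.elim _ _
    subst hl hl'
    fin_cases i <;> fin_cases i' <;>
    · simp [Fintype.sum_prod_type, Fin.sum_univ_two, onesSliceInv, sgnWeight]
      try field_simp
      try ring

/-- **`𝔖^{♭ᵀ}` is not a degeneration of the twisted star `𝔖_2(1)`**, nor is any Kronecker power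
(`N ≥ 1`, characteristic `≠ 2`). [cite: BurgisserClausenShokrollahi1997, (15.19), (15.25)] -/
theorem twistedStar_pow_not_algDegeneratesTo_signTStar (h2 : (2 : K) ≠ 0) (N : ℕ) (hN : 1 ≤ N) :
    ¬ AlgDegeneratesTo (kroneckerPow (twistedStar K 2 1) N) (kroneckerPow (signTStar K) N) := by
  classical
  obtain ⟨N', rfl⟩ := Nat.exists_eq_add_of_le' hN
  exact not_algDegeneratesTo_kroneckerPow_of_pairing (twistedStar K 2 1) (signTStar K)
    (blockPairing (-1)) (blockPairing 1) (fun w' u => blockPairing (-1) u w')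
    (fun w' u => blockPairing 1 u w') (blockPairing_leftInverse (-1) (by ring) 2 1)
    (blockPairing_leftInverse 1 (by ring) 2 1) (twistedStar_alt1 2 1) (twistedStar_alt2 2 1)
    (twistedStar_sym 2 1) onesSlice onesSliceInv (signTStar_fullSlice h2) le_rfl N'

/-- **`𝔖^♭` is not a degeneration of `𝔖_2(1)`, nor is any Kronecker power** (`N ≥ 1`, any
field: `sgn` is nowhere zero). [cite: BurgisserClausenShokrollahi1997, (15.19), (15.25)] -/
theorem twistedStar_pow_not_algDegeneratesTo_signStar (N : ℕ) (hN : 1 ≤ N) :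
    ¬ AlgDegeneratesTo (kroneckerPow (twistedStar K 2 1) N) (kroneckerPow (signStar K) N) :=
  twistedStar_pow_not_algDegeneratesTo_weightedStar 2 1 (sgnWeight K) N le_rfl le_rfl
    sgnWeight_ne_zero hN

end SignT

end Summit.MatrixMultiplication.MatrixMultiplication.Theorems.FarEdgeDescentSignTwist

end
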